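import Literature.Computability.Complexity.PRGDerandomization
import Literature.Computability.Complexity.NWQuickPRG
import Literature.Computability.Complexity.PromiseBPPAmplificationExp
import Literature.Computability.Complexity.PromiseZPPProofs
import HarnessLib

/-!
# Derandomizing promise-`BPP` with a quick pseudorandom generator (Arora–Barak 2009, Lemma 20.3, promise form)

Companion to `PRGDerandomization.lean` (`BPP_subset_P_of_fools`: a quick pseudorandom generator in
`FP` with logarithmic seed fooling polynomial-size circuits gives `BPP ⊆ P`) and `NWQuickPRG.lean`
(`exists_isSizePseudorandom_of_avgHard_E`: such a generator from a language in `E` that is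
`2^{Ω(n)}`-hard on average). This file PROVES the same derandomization for the *textbook promise
class* `PromiseBPP'` of `Promise.lean` (acceptance gap `2/3` required on the promise only):

* **`PromiseBPP'_subset_PromiseP_of_fools`** — if `F ∈ FP` and, for all large `N`,
  `seedGenerator F (c ⌊log₂ N⌋ + c) N` fools every `B₂`-circuit of size `≤ N` on `N` inputs with error
  `ε < 1/6`, then `PromiseBPP' ⊆ PromiseP` (Arora–Barak 2009, Lemma 20.3 / Cor. 20.4 (1), whose proof
  is pointwise in the input and therefore applies verbatim to promise problems; Goldreich 2006, §1.2 and
  Thm. 5.1 ff.: "Promise-BPP = Promise-P" is the standard conclusion drawn from such generators, e.g.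
  Buhrman–Fortnow–Pavan 2005, Thm. 3.1 as quoted by Hirahara 2018, proof of Cor. 4.23, and Hirahara
  2023, proof of Thm. 1.4: "by replacing random bits used by randomized algorithms with the output of
  `G`, we obtain Promise-BPP = Promise-P");
* `PromiseBPP'_subset_PromiseP_of_isSizePseudorandom` — the same from `IsSizePseudorandom` (error
  `1/N`) for all large `N`;
* **`PromiseBPP'_subset_PromiseP_of_avgHard_E`** — `PromiseBPP' ⊆ PromiseP` from a language in `E`
  that is `2^{εn}`-hard on average for all large `n` (Nisan–Wigderson 1994, Thm. 3 (1) in promise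
  form, via `exists_isSizePseudorandom_of_avgHard_E`); with `PromiseP ⊆ PromiseBPP'`
  (`PromiseP_subset_PromiseBPP'`, `PromiseZPPProofs.lean`) this is the equality
  `PromiseBPP' = PromiseP` (`PromiseBPP'_eq_PromiseP_of_avgHard_E`).

## Proof

Verbatim the proof of `BPP_subset_P_of_fools` (Arora–Barak 2009, pp. 474–475), which never uses the
gap off the input at hand: for `Q ∈ PromiseBPP'` with witness `(L' ∈ P, p)`, the deterministic
majority vote `PRGDerand.verdictF L' p F c Nb` over all seeds (an `FP` function,
`PRGDerand.verdictF_mem_FP`) accepts every long yes-instance and rejects every long no-instance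
(`PRGDerand.mem_iff_verdictF`, applied to the languages `Q.yes` and `Q.noᶜ` respectively: on a
yes-instance `x` the event `{y | ⟨x,y⟩ ∈ L' ↔ x ∈ Q.yes}` is the acceptance event, on a no-instance
the event `{y | ⟨x,y⟩ ∈ L' ↔ x ∈ Q.noᶜ}` is the rejection event); the finitely many short inputs are
patched with the indicator of `Q.yes` (`mem_FP_of_eqOn_le`), which rejects the short no-instances
because members of `PromiseBPP'` are disjoint (`PromiseProblem.disjoint_of_mem_PromiseBPP'`,
`PromiseBPPAmplificationExp.lean`); the language `{w | g w = [1]}` of the patched verdict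
is in `P` (`mem_P_of_mem_FP`) and separates `Q`.

## References

* S. Arora, B. Barak, *Computational Complexity: A Modern Approach*, CUP 2009, Lemma 20.3 and its
  proof (pp. 474–475), Cor. 20.4 (1), Thm. 20.6 [AroraBarakCC2009].
* N. Nisan, A. Wigderson, *Hardness vs randomness*, JCSS 49 (1994) 149–167, Thm. 1, Thm. 3 (1)
  [NisanWigderson1994].
* O. Goldreich, *On promise problems: a survey*, in: Theoretical Computer Science — Essays in Memory
  of Shimon Even, LNCS 3895 (2006) 254–290, §1.2 (promise-BPP), §5 [Goldreich2006].
* H. Buhrman, L. Fortnow, A. Pavan, *Some results on derandomization*, Theory Comput. Syst. 38 (2005)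
  211–227, Thm. 3.1 [BuhrmanFortnowPavan2004]; S. Hirahara, ECCC TR18-138 rev. 1 (2019), proof of
  Cor. 4.23 [Hirahara2018] (the consumers of the promise form).

## Design notes

No definition and no named fact is introduced; the machine, its `FP` certificate and its correctness
on long inputs are those of `PRGDerandomization.lean` (namespace `PRGDerand`), reused unchanged.
-/

noncomputable section

namespace Literature.Computability.Complexity

open _root_.Computability Finset Filter Polynomial Brick

/-! ### The theorem -/

open PRGDerand in
/-- **Derandomizing promise-`BPP` with a quick generator** (Arora–Barak 2009, Lemma 20.3 and
Cor. 20.4 (1), promise form; Goldreich 2006, §1.2): if a string function `F ∈ FP` yields, for all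
large `N`, a generator `s ↦ F⟨1^N, s⟩↾N` on seeds of length `c ⌊log₂ N⌋ + c` that fools every
`B₂`-circuit of size `≤ N` on `N` inputs with error `ε < 1/6` (`Fools`, `HardnessVsRandomness.lean`),
then `PromiseBPP' ⊆ PromiseP`: the majority vote over all seeds (`PRGDerand.verdictF`, in `FP`)
accepts the long yes-instances and rejects the long no-instances of any `Q ∈ PromiseBPP'`
(`PRGDerand.mem_iff_verdictF` at the languages `Q.yes`, `Q.noᶜ`), the short inputs being patched by
the indicator of `Q.yes`. [cite: AroraBarakCC2009, Lemma 20.3 and Cor. 20.4 (1)]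
[cite: Goldreich2006, §1.2] -/
theorem PromiseBPP'_subset_PromiseP_of_fools {F : List Bool → List Bool} (hF : F ∈ FP) (c : ℕ) {ε : ℝ}
    (hε : ε < 1 / 6) (hG : ∀ᶠ N in atTop, Fools (seedGenerator F (c * Nat.log 2 N + c) N) N ε) :
    PromiseBPP' ⊆ PromiseP := by
  intro Q hQ
  have hdisj : Q.Disjoint := PromiseProblem.disjoint_of_mem_PromiseBPP' hQ
  obtain ⟨L', hL', p, hyes, hno⟩ := hQ
  obtain ⟨q, hq⟩ := exists_cktSize_boolPair_of_mem_PPoly (P_subset_PPoly_holds hL')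
  obtain ⟨N₀, hN₀⟩ := Filter.eventually_atTop.1 hG
  -- the output length `N(n)`: above the distinguisher size, the coin count and `n`
  let Nb : Polynomial ℕ := 2 * X + 2 + p + q.comp (2 * X + 2 + p) + 2 + X
  have hNb : ∀ n, Nb.eval n = 2 * n + 2 + p.eval n + q.eval (2 * n + 2 + p.eval n) + 2 + n := by
    intro n; simp [Nb]
  -- the verdict, compared with any language `L` having the `bp`-gap at `x`, on a long input `x`
  have key : ∀ (L : Language Bool) (x : List Bool), N₀ ≤ x.length →
      2 / 3 ≤ uniformProb (p.eval x.length) {y : List Bool | boolPair x y ∈ L' ↔ x ∈ L} →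
      (x ∈ L ↔ verdictF L' p F c Nb x = [true]) := by
    intro L x hx hbp
    have hmN : p.eval x.length ≤ Nb.eval x.length := by rw [hNb]; omega
    obtain ⟨C, hB, hs, hC⟩ := exists_circuit_hardwire (hq x.length (p.eval x.length)) x rfl hmN
    refine mem_iff_verdictF L' p F c Nb x rfl rfl rfl hbp hε hmN C hB
      (hs.trans (by rw [hNb]; omega)) hC ?_
    exact hN₀ _ ((hx.trans (by rw [hNb]; omega)))
  -- long yes-instances are accepted
  have keyY : ∀ x ∈ Q.yes, N₀ ≤ x.length → verdictF L' p F c Nb x = [true] := by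
    intro x hx hlen
    refine (key Q.yes x hlen ?_).1 hx
    have hset : {y : List Bool | boolPair x y ∈ L' ↔ x ∈ Q.yes} = {y | boolPair x y ∈ L'} :=
      Set.ext fun y => ⟨fun h => h.2 hx, fun h => ⟨fun _ => hx, fun _ => h⟩⟩
    rw [hset]
    exact hyes x hx
  -- long no-instances are rejected
  have keyN : ∀ x ∈ Q.no, N₀ ≤ x.length → verdictF L' p F c Nb x ≠ [true] := by
    intro x hx hlen hv
    have hx' : x ∉ Q.noᶜ := fun h => h hx
    refine hx' ((key Q.noᶜ x hlen ?_).2 hv)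
    have hset : {y : List Bool | boolPair x y ∈ L' ↔ x ∈ Q.noᶜ} = {y | boolPair x y ∉ L'} :=
      Set.ext fun y =>
        ⟨fun h hp => hx' (h.1 hp), fun hn => ⟨fun hp => absurd hp hn, fun hc => absurd hc hx'⟩⟩
    rw [hset]
    exact hno x hx
  -- patch the short inputs with the indicator of `Q.yes`
  let g : List Bool → List Bool := fun x =>
    if x.length < N₀ then [Q.yes.boolIndicator x] else verdictF L' p F c Nb x
  have hg : g ∈ FP :=
    mem_FP_of_eqOn_le (verdictF_mem_FP p c Nb hL' hF) N₀ fun z hz => by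
      simp only [g, if_neg (not_lt.2 hz)]
  -- the patched verdict is one bit
  have hbit : ∀ w, ∃ b : Bool, g w = [b] := by
    intro w
    by_cases hlen : w.length < N₀
    · exact ⟨Q.yes.boolIndicator w, by simp only [g, if_pos hlen]⟩
    · refine ⟨decide (2 ^ seedLen c (Nb.eval w.length) < 2 * accCount L' p F c Nb w), ?_⟩
      simp only [g, if_neg hlen]
      exact verdictF_apply L' p F c Nb w
  have hP : {w | g w = [true]} ∈ Classes.P := by
    refine mem_P_of_mem_FP hg {w | g w = [true]} fun w => ⟨fun hw => hw, fun hw => ?_⟩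
    obtain ⟨b, hb⟩ := hbit w
    have hb' : b ≠ true := fun h => hw (show g w = [true] by rw [hb, h])
    rw [hb, Bool.eq_false_iff.2 hb']
  refine ⟨{w | g w = [true]}, hP, fun x hx => ?_, fun x hx => ?_⟩
  · -- yes-instances are accepted
    show g x = [true]
    by_cases hlen : x.length < N₀
    · simp only [g, if_pos hlen, (Set.mem_iff_boolIndicator _ _).1 hx]
    · simp only [g, if_neg hlen]
      exact keyY x hx (not_lt.1 hlen)
  · -- no-instances are rejected
    show ¬ g x = [true]
    have hxy : x ∉ Q.yes := fun h => (Set.disjoint_left.1 hdisj) h hx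
    by_cases hlen : x.length < N₀
    · simp only [g, if_pos hlen, (Set.notMem_iff_boolIndicator _ _).1 hxy]
      simp
    · simp only [g, if_neg hlen]
      exact keyN x hx (not_lt.1 hlen)

/-- **Corollary**: a quick `SIZE(N)`-pseudorandom generator with logarithmic seed
(`IsSizePseudorandom` for all large `N`, i.e. error `1/N`) gives `PromiseBPP' ⊆ PromiseP`.
[cite: AroraBarakCC2009, Cor. 20.4 (1)] [cite: Goldreich2006, §1.2] -/
theorem PromiseBPP'_subset_PromiseP_of_isSizePseudorandom {F : List Bool → List Bool} (hF : F ∈ FP)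
    (c : ℕ) (hG : ∀ᶠ N in atTop, IsSizePseudorandom (seedGenerator F (c * Nat.log 2 N + c) N)) :
    PromiseBPP' ⊆ PromiseP := by
  refine PromiseBPP'_subset_PromiseP_of_fools hF c (ε := 1 / 7) (by norm_num) ?_
  filter_upwards [hG, Filter.eventually_ge_atTop 7] with N hN hN7
  refine hN.mono le_rfl ?_
  have : (7 : ℝ) ≤ N := by exact_mod_cast hN7
  exact one_div_le_one_div_of_le (by norm_num) this

/-- **`Promise-BPP ⊆ Promise-P` from an average-case hard language in `E`** (Nisan–Wigderson
1994, Thm. 3 (1), promise form; Arora–Barak 2009, Thm. 20.6 with Lemma 20.3 / Cor. 20.4 (1)): the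
quick generator of `exists_isSizePseudorandom_of_avgHard_E` (`NWQuickPRG.lean`) fed to
`PromiseBPP'_subset_PromiseP_of_isSizePseudorandom`. This is the first sentence of the proof of
Buhrman–Fortnow–Pavan's Thm. 3.1 ("… then by Theorem 3.2 [Impagliazzo–Wigderson] we have that
pseudorandom generators exist and we are done") in the average-case-hardness regime.
[cite: NisanWigderson1994, Thm. 3 (1)] [cite: AroraBarakCC2009, Thm. 20.6 and Cor. 20.4 (1)] -/
theorem PromiseBPP'_subset_PromiseP_of_avgHard_E {L : Language Bool} (hL : L ∈ E) {ε : ℝ}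
    (hε : 0 < ε)
    (hhard : ∀ᶠ n in atTop, MetaComplexity.AvgHardAtLeast (L.sliceFn n) ((2 : ℝ) ^ (ε * n))) :
    PromiseBPP' ⊆ PromiseP := by
  obtain ⟨F, c, hF, h⟩ := exists_isSizePseudorandom_of_avgHard_E hL hε hhard
  exact PromiseBPP'_subset_PromiseP_of_isSizePseudorandom hF c h

/-- **`Promise-BPP = Promise-P` from an average-case hard language in `E`**: the previous
inclusion together with `PromiseP ⊆ PromiseBPP'` (`PromiseP_subset_PromiseBPP'`,
`PromiseZPPProofs.lean`). [cite: NisanWigderson1994, Thm. 3 (1)] [cite: Goldreich2006, §1.2] -/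
theorem PromiseBPP'_eq_PromiseP_of_avgHard_E {L : Language Bool} (hL : L ∈ E) {ε : ℝ} (hε : 0 < ε)
    (hhard : ∀ᶠ n in atTop, MetaComplexity.AvgHardAtLeast (L.sliceFn n) ((2 : ℝ) ^ (ε * n))) :
    PromiseBPP' = PromiseP :=
  Set.Subset.antisymm (PromiseBPP'_subset_PromiseP_of_avgHard_E hL hε hhard) PromiseP_subset_PromiseBPP'

end Literature.Computability.Complexity

end
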